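import Summits.Ventures.CertifiedManyBodySolver.Downfold.TPrimePinnedPairRowKernelChainQuotAdjNear
import Summits.Ventures.CertifiedManyBodySolver.Rows.CARPolyWindowGramTBRows
import HarnessLib

/-!
# The PINNED t′-PAIR shape from TWO `stepEQA` chains over EOM-NEAR sliced residuals whose GRAM SLICES carry an ANTI-HERMITIAN REMAINDER
# (the «(N)-by-rows + adjoint halving» input shape): `SquareTTPrimePinnedPairRowT.of_quotAdjChainNearKernelCertsGX_wide` (explicit eom masks)
# and `…GXAuto_wide` (kernel-computed masks), on ANY outer letter window `Λ' ⊇ Λ₇ = box 2 7`;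
# cell `pub/hubbard-obs` × `pub/hubbard-downfold`, D-0154 (1)(C) COVERAGE La214; seat `hubbard-cov-la214-unc-2`, lineage desk; zero compute

HONEST FRAMING: Lean plumbing towards «tier P» for PAIR claim nodes‴ — the T-shape PAIR twin of hubbard-obs-p2's single-vertex closers
`CARPolyWindow.affineOrbitLowerRowN_of_quotAdjChainKernelCertGX{Near,Auto}` (`Rows/CARPolyWindowGramTBRows.lean`, p684213). With the exporter's
adjoint-pair HALVING the per-vertex Gram slice list (`gramTBRowsHalf K blocks`: row `a` against `b ≥ a`, off-diagonal doubled) no longer denotes a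
`gramForm`; it denotes `termOp TGf − termOp V + (termOp V)ᴴ` for a NAMED full list `TGf` (a PSD `gramForm Λm O`) and a remainder `V` (a proof
object, never a kernel slice). So, per vertex, the hypothesis `hTG_v` of `SquareTTPrimePinnedPairRowT.of_quotAdjChainNearKernelCertsG_wide`
(p679687 §1) is replaced by `hTGf_v : termOp d TGf_v = gramForm Λm_v O_v` and `hG_v : termOp d TGs_v.flatten = termOp d TGf_v − termOp d V_v +
(termOp d V_v)ᴴ`; everything else (shared tables `D : QuotData N Nβ` on `Λ'`, letters, ONE eom word list `EB`, per-vertex dictionaries, objective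
`termOp d TX_v = Γ(incl h7)(X s_v)`, rows, masks with the far check, charged words, anti-Hermitian parts, the hinted + adjoint chain
`ChainQAOK D Bkey M Cs (groupSlices (residTGslicesNear … TGs_v TH_v D.f EB masks_v ∅ ∅ CW_v AV_v) ns_v) Hs_v`, ONE price `hβ_v`) is as there
⟹ `SquareTTPrimePinnedPairRowT U n₀ sA sB capA capB flA flB βA κA κA' βB κB κB' X` via this base's `…of_residPolys_wide` (p678325). Proof per
vertex = p679687 §1's lines (accepted family `allMovesZ`, adjoint generators `allAdj`, licences, semantic residual) + ONE rewrite with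
hubbard-obs-p2's `termOp_residTG_gramX`, which moves `V_v` into the anti-Hermitian family `(AV_v ++ allAdj …) ++ [V_v]` whose real expectations
the Literature theorem already kills. `…GXAuto_wide` = the same with `masks_v := autoMasks TH_v D.f EB` (`eomFarOK_autoMasks`, p683122).
Nothing is asserted: no `def`, no named fact, no `sorry`, no number; no chain of record exists (nothing evaluated); CONTROL / CALIBRATION wording
class (xx1); no summit statement is proved by this file.

References: X. Han, arXiv:2006.06002 §2 eq. (2), §3 [Han2020Bootstrap]; J. Wang et al., PRX 14 (2024) 031006 §III [WangEtAl2024]; C. Jansson,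
D. Chaykin, C. Keil, SIAM J. Numer. Anal. 46 (2008) 180 [JanssonChaykinKeil2008]; D. P. Bertsekas, *Nonlinear Programming* (1999) Prop. 5.1.3
[Bertsekas1999NonlinearProgramming]; O. Bratteli, D. W. Robinson, *Operator Algebras and Quantum Statistical Mechanics 2* §5.2.2
[BratteliRobinsonII1997].
-/

noncomputable section

namespace Summit.Ventures.CertifiedManyBodySolver.Downfold

open Literature.MathematicalPhysics.QuantumLattice
open Matrix HubbardWave0 Literature.Probability.LatticeModels ThermodynamicLimit Filter Topology
open Literature.MathematicalPhysics.QuantumManyBody.StateRelaxation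
open Summit.Ventures.CertifiedQuantumChemistry Summit.Ventures.CertifiedQuantumChemistry.CARPoly
open Summit.Ventures.CertifiedManyBodySolver.CARPolyWindow
open scoped BigOperators ComplexOrder

/-! ## §1 TWO `stepEQA` chains over EOM-NEAR sliced residuals, Gram slices WITH AN ANTI-HERMITIAN REMAINDER, outer window `Λ' ⊇ Λ₇` -/

section KernelPairChainQuotAdjNearGX

variable {N Nβ : ℕ} [NeZero N]

/-- **KERNEL FORM OF THE PAIR NODE‴ — «ROWS + HALVING» INPUT SHAPE, ABSTRACT GRAM WITH ANTI-HERMITIAN REMAINDER, WIDE WINDOW, EXPLICIT MASKS.**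
Shared: station `(U, n₀)` rational, hoppings `sA, sB`, windows `Λ ⊆ Λ' ⊇ box 2 7`, tables `D : QuotData N Nβ` on `Λ'` with their specifications,
letters `d`/`dΛ` in table form, the table licence fact `hokV`, origin letters, the objective family `X` (embedded by `incl h7`), ONE eom word list
`EB`; per vertex: dictionaries at `(1, s_v, U)`, objective `termOp d TX_v = Γ(incl h7)(X s_v)`, density / cap / cut rows, the chain's Gram slices
`TGs_v`, a NAMED full list `TGf_v` with `termOp d TGf_v = gramForm Λm_v O_v`, `Λm_v ⪰ 0`, a remainder `V_v` with `termOp d TGs_v.flatten =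
termOp d TGf_v − termOp d V_v + (termOp d V_v)ᴴ`, eom-near masks with the far check, charged words, anti-Hermitian parts, the hinted + adjoint
chain `(ns, M, Cs, hC0, Hs, hchain)` over `residTGslicesNear`, and the price `hβ_v`
⟹ `SquareTTPrimePinnedPairRowT U n₀ sA sB capA capB flA flB βA κA κA' βB κB κB' X`.
[cite: WangEtAl2024, §III] [cite: Han2020Bootstrap, §3] [cite: JanssonChaykinKeil2008, §3] [cite: Bertsekas1999NonlinearProgramming, Prop. 5.1.3]
[cite: BratteliRobinsonII1997, §5.2.2] -/
theorem SquareTTPrimePinnedPairRowT.of_quotAdjChainNearKernelCertsGX_wide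
    (U : ℚ) (hU : 0 ≤ U) (n₀ : ℚ) (hn0 : 0 ≤ n₀) (hn2 : n₀ < 2) (sA sB : ℚ)
    {Λ Λ' : Finset (Site 2)} (h7 : box 2 7 ⊆ Λ') (hΛ : Λ ⊆ Λ') (h8 : thicken Λ 1 ⊆ Λ')
    (h0 : thicken ({0} : Finset (Site 2)) 1 ⊆ Λ') (hz : (0 : Site 2) ∈ Λ')
    -- tables and letters (shared)
    (D : QuotData N Nβ) (hxs : ∀ i, D.xs i ∈ Λ') (hix : ∀ y ∈ Λ', D.xs (D.ix y) = y)
    (hxsβ : ∀ j, D.xsβ j ∈ Λ) (hcovβ : ∀ x ∈ Λ, ∃ j, D.xsβ j = x)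
    (d : Orb (Fin N) → Orb (PolySite Λ')) (hd : Function.Injective d)
    (hdx : ∀ i σ, d (orb i σ) = orb (PolySite.pt (D.xs i) (hxs i)) σ) (Bkey : ℕ)
    (dΛ : Orb (Fin Nβ) → Orb (PolySite Λ)) (hdΛ : ∀ j σ, dΛ (orb j σ) = orb (PolySite.pt (D.xsβ j) (hxsβ j)) σ)
    (hf : ∀ b, d (D.f b) = Orb.embMap (PolySite.incl hΛ) (dΛ b))
    (sp : Orb (Fin N) → Fin 2) (hsp : ∀ a, (ofLex (d a)).2 = sp a)
    (hokV : ∀ γc v, D.ok γc v = true →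
      ∀ j : Fin Nβ, D.xs (D.ix (d4Vec (d4OfCode γc) (D.xsβ j) + siteOfPair v)) = d4Vec (d4OfCode γc) (D.xsβ j) + siteOfPair v)
    (o : Fin 2 → Orb (Fin N)) (ho : ∀ σ, d (o σ) = orb (PolySite.pt 0 hz) σ)
    -- the objective family and the SHARED eom words
    (X : ℝ → FermionOp (box 2 7)) (EB : List (Terms (Orb (Fin Nβ))))
    -- vertex A
    (THA : Terms (Orb (Fin N))) (hHA : termOp d THA = (hubbardTTPrimeFermionInteraction 1 (sA : ℝ) (U : ℝ)).localHamiltonian Λ')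
    (TEA : Terms (Orb (Fin N)))
    (hEA : termOp d TEA = fermionEmbed (PolySite.incl h0) ((hubbardTTPrimeFermionInteraction 1 (sA : ℝ) (U : ℝ)).meanEnergyObs 1))
    (TXA : Terms (Orb (Fin N))) (hXA : termOp d TXA = fermionEmbed (PolySite.incl h7) (X (sA : ℝ)))
    (μA : Fin 2 → ℚ) (νA κA capA κA' flA : ℚ)
    (TGsA : List (Terms (Orb (Fin N)))) (TGfA VA : Terms (Orb (Fin N)))
    {mA : Type*} [Fintype mA] [DecidableEq mA] {ΛmA : Matrix mA mA ℂ} (hΛmA : ΛmA.PosSemidef)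
    (OA : mA → FermionOp Λ') (hTGfA : termOp d TGfA = gramForm ΛmA OA)
    (hGA : termOp d TGsA.flatten = termOp d TGfA - termOp d VA + (termOp d VA)ᴴ)
    (masksA : List (List Bool)) (hfarA : eomFarOK THA D.f EB masksA = true)
    (CWA : Terms (Orb (Fin N))) (hcwA : ∀ wc ∈ CWA, chargeW wc.1 ≠ 0 ∨ spinChargeW sp wc.1 ≠ 0)
    (AVA : List (Terms (Orb (Fin N))))
    (nsA : List ℕ) (MA : ℕ) (CsA : List SOSDual.EncPoly) (hC0A : CsA.getD 0 [] = []) (HsA : List (List (QHint Nβ)))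
    (hchainA : ChainQAOK D Bkey MA CsA
      (groupSlices (residTGslicesNear TXA μA νA o κA capA κA' flA TEA TGsA THA D.f EB masksA
        (fun l : Fin 0 => l.elim0) (fun l : Fin 0 => l.elim0) CWA AVA) nsA) HsA)
    {βA : ℚ} (hβA : βA ≤ lowerConst (SOSDual.decPoly N (CsA.getD MA [])) + (μA 0 + μA 1) * (n₀ / 2 - νA))
    -- vertex B
    (THB : Terms (Orb (Fin N))) (hHB : termOp d THB = (hubbardTTPrimeFermionInteraction 1 (sB : ℝ) (U : ℝ)).localHamiltonian Λ')
    (TEB : Terms (Orb (Fin N)))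
    (hEB : termOp d TEB = fermionEmbed (PolySite.incl h0) ((hubbardTTPrimeFermionInteraction 1 (sB : ℝ) (U : ℝ)).meanEnergyObs 1))
    (TXB : Terms (Orb (Fin N))) (hXB : termOp d TXB = fermionEmbed (PolySite.incl h7) (X (sB : ℝ)))
    (μB : Fin 2 → ℚ) (νB κB capB κB' flB : ℚ)
    (TGsB : List (Terms (Orb (Fin N)))) (TGfB VB : Terms (Orb (Fin N)))
    {mB : Type*} [Fintype mB] [DecidableEq mB] {ΛmB : Matrix mB mB ℂ} (hΛmB : ΛmB.PosSemidef)
    (OB : mB → FermionOp Λ') (hTGfB : termOp d TGfB = gramForm ΛmB OB)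
    (hGB : termOp d TGsB.flatten = termOp d TGfB - termOp d VB + (termOp d VB)ᴴ)
    (masksB : List (List Bool)) (hfarB : eomFarOK THB D.f EB masksB = true)
    (CWB : Terms (Orb (Fin N))) (hcwB : ∀ wc ∈ CWB, chargeW wc.1 ≠ 0 ∨ spinChargeW sp wc.1 ≠ 0)
    (AVB : List (Terms (Orb (Fin N))))
    (nsB : List ℕ) (MB : ℕ) (CsB : List SOSDual.EncPoly) (hC0B : CsB.getD 0 [] = []) (HsB : List (List (QHint Nβ)))
    (hchainB : ChainQAOK D Bkey MB CsB
      (groupSlices (residTGslicesNear TXB μB νB o κB capB κB' flB TEB TGsB THB D.f EB masksB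
        (fun l : Fin 0 => l.elim0) (fun l : Fin 0 => l.elim0) CWB AVB) nsB) HsB)
    {βB : ℚ} (hβB : βB ≤ lowerConst (SOSDual.decPoly N (CsB.getD MB [])) + (μB 0 + μB 1) * (n₀ / 2 - νB)) :
    SquareTTPrimePinnedPairRowT (U : ℝ) (n₀ : ℝ) (sA : ℝ) (sB : ℝ) capA capB flA flB βA κA κA' βB κB κB' X := by
  -- vertex A: the accepted move family of its hinted chain, the recorded adjoint generators, the licences, the semantic residual
  set TsA := groupSlices (residTGslicesNear TXA μA νA o κA capA κA' flA TEA TGsA THA D.f EB masksA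
    (fun l : Fin 0 => l.elim0) (fun l : Fin 0 => l.elim0) CWA AVA) nsA with hTsA
  set LA := allMovesZ D Bkey TsA HsA MA with hLA
  set LAA := allAdj D Bkey TsA HsA MA with hLAA
  have hLokA : ∀ n, ∀ mv ∈ allMovesZ D Bkey TsA HsA n, D.ok mv.1 mv.2.1 = true := by
    intro n
    induction n with
    | zero => intro mv hmv; rw [allMovesZ_zero] at hmv; exact absurd hmv List.not_mem_nil
    | succ n ih =>
      intro mv hmv
      rw [allMovesZ_succ, List.mem_append] at hmv
      rcases hmv with hmv | hmv
      · exact ih mv hmv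
      · rw [movesOfZ, quotMovesZ, List.mem_filterMap] at hmv
        obtain ⟨a, ha, hmap⟩ := hmv
        obtain ⟨e, hae, hFe⟩ := Option.map_eq_some_iff.1 hmap
        obtain ⟨hok, -, -⟩ := annotate_ok D Bkey _ _ a ha e hae
        rw [← hFe]
        exact hok
  let γfA : Fin LA.length → DihedralGroup 4 := fun l => d4OfCode (LA.get l).1
  let wvfA : Fin LA.length → Site 2 := fun l => siteOfPair (LA.get l).2.1
  let gfA : Fin LA.length → Orb (Fin Nβ) → Orb (Fin N) := fun l => gq D (γfA l) (wvfA l)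
  let SYfA : Fin LA.length → Terms (Orb (Fin Nβ)) := fun l => (LA.get l).2.2
  have hshA : ∀ l, d4ShiftSet (γfA l) (wvfA l) Λ ⊆ Λ' := fun l =>
    shiftSet_subset_of_table D hxs hcovβ (γfA l) (wvfA l) (hokV _ _ (hLokA MA _ (List.get_mem LA l)))
  have hgA : ∀ l b, d (gfA l b) = Orb.embMap (PolySite.incl (hshA l)) (Orb.embMap (PolySite.d4Emb (γfA l) (wvfA l) Λ) (dΛ b)) :=
    fun l b => by rw [← orb_ofLex_eq b]; exact d_gq D hxs d hdx hix hxsβ dΛ hdΛ (γfA l) (wvfA l) (hshA l) _ _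
  have hRA : evalPoly d (SOSDual.decPoly N (CsA.getD MA [])) =
      termOp d (residTG TXA μA νA o κA capA κA' flA TEA TGsA.flatten THA D.f EB gfA SYfA CWA (AVA ++ LAA)) := by
    rw [evalPoly_chainQA_nil hd hC0A hchainA, hTsA, flatten_groupSlices,
      termOp_flatten_residTGslicesNear hd TXA μA νA o κA capA κA' flA TEA _ THA D.f EB masksA _ _ CWA AVA hfarA,
      termOp_residTG_moves_adj d TXA μA νA o κA capA κA' flA TEA _ THA D.f EB gfA SYfA CWA AVA LAA, ← hLA, ← hLAA,
      termOp_symTL_eq]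
  -- … the Gram remainder of vertex A moved into the adjoint family
  rw [termOp_residTG_gramX d TXA μA νA o κA capA κA' flA TEA TGsA.flatten TGfA VA hGA THA D.f EB gfA SYfA CWA (AVA ++ LAA)] at hRA
  -- vertex B: the accepted move family of its hinted chain, the recorded adjoint generators, the licences, the semantic residual
  set TsB := groupSlices (residTGslicesNear TXB μB νB o κB capB κB' flB TEB TGsB THB D.f EB masksB
    (fun l : Fin 0 => l.elim0) (fun l : Fin 0 => l.elim0) CWB AVB) nsB with hTsB
  set LB := allMovesZ D Bkey TsB HsB MB with hLB
  set LAB := allAdj D Bkey TsB HsB MB with hLAB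
  have hLokB : ∀ n, ∀ mv ∈ allMovesZ D Bkey TsB HsB n, D.ok mv.1 mv.2.1 = true := by
    intro n
    induction n with
    | zero => intro mv hmv; rw [allMovesZ_zero] at hmv; exact absurd hmv List.not_mem_nil
    | succ n ih =>
      intro mv hmv
      rw [allMovesZ_succ, List.mem_append] at hmv
      rcases hmv with hmv | hmv
      · exact ih mv hmv
      · rw [movesOfZ, quotMovesZ, List.mem_filterMap] at hmv
        obtain ⟨a, ha, hmap⟩ := hmv
        obtain ⟨e, hae, hFe⟩ := Option.map_eq_some_iff.1 hmap
        obtain ⟨hok, -, -⟩ := annotate_ok D Bkey _ _ a ha e hae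
        rw [← hFe]
        exact hok
  let γfB : Fin LB.length → DihedralGroup 4 := fun l => d4OfCode (LB.get l).1
  let wvfB : Fin LB.length → Site 2 := fun l => siteOfPair (LB.get l).2.1
  let gfB : Fin LB.length → Orb (Fin Nβ) → Orb (Fin N) := fun l => gq D (γfB l) (wvfB l)
  let SYfB : Fin LB.length → Terms (Orb (Fin Nβ)) := fun l => (LB.get l).2.2
  have hshB : ∀ l, d4ShiftSet (γfB l) (wvfB l) Λ ⊆ Λ' := fun l =>
    shiftSet_subset_of_table D hxs hcovβ (γfB l) (wvfB l) (hokV _ _ (hLokB MB _ (List.get_mem LB l)))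
  have hgB : ∀ l b, d (gfB l b) = Orb.embMap (PolySite.incl (hshB l)) (Orb.embMap (PolySite.d4Emb (γfB l) (wvfB l) Λ) (dΛ b)) :=
    fun l b => by rw [← orb_ofLex_eq b]; exact d_gq D hxs d hdx hix hxsβ dΛ hdΛ (γfB l) (wvfB l) (hshB l) _ _
  have hRB : evalPoly d (SOSDual.decPoly N (CsB.getD MB [])) =
      termOp d (residTG TXB μB νB o κB capB κB' flB TEB TGsB.flatten THB D.f EB gfB SYfB CWB (AVB ++ LAB)) := by
    rw [evalPoly_chainQA_nil hd hC0B hchainB, hTsB, flatten_groupSlices,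
      termOp_flatten_residTGslicesNear hd TXB μB νB o κB capB κB' flB TEB _ THB D.f EB masksB _ _ CWB AVB hfarB,
      termOp_residTG_moves_adj d TXB μB νB o κB capB κB' flB TEB _ THB D.f EB gfB SYfB CWB AVB LAB, ← hLB, ← hLAB,
      termOp_symTL_eq]
  -- … the Gram remainder of vertex B moved into the adjoint family
  rw [termOp_residTG_gramX d TXB μB νB o κB capB κB' flB TEB TGsB.flatten TGfB VB hGB THB D.f EB gfB SYfB CWB (AVB ++ LAB)] at hRB
  exact SquareTTPrimePinnedPairRowT.of_residPolys_wide U hU n₀ hn0 hn2 sA sB h7 hΛ h8 h0 hz d dΛ D.f hf sp hsp o ho X EB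
    THA hHA TEA hEA TXA hXA μA νA κA capA κA' flA TGfA hΛmA OA hTGfA γfA wvfA hshA gfA hgA SYfA CWA hcwA ((AVA ++ LAA) ++ [VA]) hRA hβA
    THB hHB TEB hEB TXB hXB μB νB κB capB κB' flB TGfB hΛmB OB hTGfB γfB wvfB hshB gfB hgB SYfB CWB hcwB ((AVB ++ LAB) ++ [VB]) hRB hβB

/-- **KERNEL FORM OF THE PAIR NODE‴ — «ROWS + HALVING» INPUT SHAPE, ABSTRACT GRAM WITH ANTI-HERMITIAN REMAINDER, WIDE WINDOW, KERNEL-COMPUTED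
EOM MASKS**: as `SquareTTPrimePinnedPairRowT.of_quotAdjChainNearKernelCertsGX_wide` with `masks_v := autoMasks TH_v D.f EB` (hubbard-obs-p2's
`eomFarOK_autoMasks`: no mask data, no far-check declaration — two arguments fewer per vertex). [cite: WangEtAl2024, §III] [cite: Han2020Bootstrap, §3]
[cite: JanssonChaykinKeil2008, §3] [cite: BratteliRobinsonII1997, §5.2.2] -/
theorem SquareTTPrimePinnedPairRowT.of_quotAdjChainNearKernelCertsGXAuto_wide
    (U : ℚ) (hU : 0 ≤ U) (n₀ : ℚ) (hn0 : 0 ≤ n₀) (hn2 : n₀ < 2) (sA sB : ℚ)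
    {Λ Λ' : Finset (Site 2)} (h7 : box 2 7 ⊆ Λ') (hΛ : Λ ⊆ Λ') (h8 : thicken Λ 1 ⊆ Λ')
    (h0 : thicken ({0} : Finset (Site 2)) 1 ⊆ Λ') (hz : (0 : Site 2) ∈ Λ')
    -- tables and letters (shared)
    (D : QuotData N Nβ) (hxs : ∀ i, D.xs i ∈ Λ') (hix : ∀ y ∈ Λ', D.xs (D.ix y) = y)
    (hxsβ : ∀ j, D.xsβ j ∈ Λ) (hcovβ : ∀ x ∈ Λ, ∃ j, D.xsβ j = x)
    (d : Orb (Fin N) → Orb (PolySite Λ')) (hd : Function.Injective d)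
    (hdx : ∀ i σ, d (orb i σ) = orb (PolySite.pt (D.xs i) (hxs i)) σ) (Bkey : ℕ)
    (dΛ : Orb (Fin Nβ) → Orb (PolySite Λ)) (hdΛ : ∀ j σ, dΛ (orb j σ) = orb (PolySite.pt (D.xsβ j) (hxsβ j)) σ)
    (hf : ∀ b, d (D.f b) = Orb.embMap (PolySite.incl hΛ) (dΛ b))
    (sp : Orb (Fin N) → Fin 2) (hsp : ∀ a, (ofLex (d a)).2 = sp a)
    (hokV : ∀ γc v, D.ok γc v = true →
      ∀ j : Fin Nβ, D.xs (D.ix (d4Vec (d4OfCode γc) (D.xsβ j) + siteOfPair v)) = d4Vec (d4OfCode γc) (D.xsβ j) + siteOfPair v)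
    (o : Fin 2 → Orb (Fin N)) (ho : ∀ σ, d (o σ) = orb (PolySite.pt 0 hz) σ)
    -- the objective family and the SHARED eom words
    (X : ℝ → FermionOp (box 2 7)) (EB : List (Terms (Orb (Fin Nβ))))
    -- vertex A
    (THA : Terms (Orb (Fin N))) (hHA : termOp d THA = (hubbardTTPrimeFermionInteraction 1 (sA : ℝ) (U : ℝ)).localHamiltonian Λ')
    (TEA : Terms (Orb (Fin N)))
    (hEA : termOp d TEA = fermionEmbed (PolySite.incl h0) ((hubbardTTPrimeFermionInteraction 1 (sA : ℝ) (U : ℝ)).meanEnergyObs 1))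
    (TXA : Terms (Orb (Fin N))) (hXA : termOp d TXA = fermionEmbed (PolySite.incl h7) (X (sA : ℝ)))
    (μA : Fin 2 → ℚ) (νA κA capA κA' flA : ℚ)
    (TGsA : List (Terms (Orb (Fin N)))) (TGfA VA : Terms (Orb (Fin N)))
    {mA : Type*} [Fintype mA] [DecidableEq mA] {ΛmA : Matrix mA mA ℂ} (hΛmA : ΛmA.PosSemidef)
    (OA : mA → FermionOp Λ') (hTGfA : termOp d TGfA = gramForm ΛmA OA)
    (hGA : termOp d TGsA.flatten = termOp d TGfA - termOp d VA + (termOp d VA)ᴴ)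
    (CWA : Terms (Orb (Fin N))) (hcwA : ∀ wc ∈ CWA, chargeW wc.1 ≠ 0 ∨ spinChargeW sp wc.1 ≠ 0)
    (AVA : List (Terms (Orb (Fin N))))
    (nsA : List ℕ) (MA : ℕ) (CsA : List SOSDual.EncPoly) (hC0A : CsA.getD 0 [] = []) (HsA : List (List (QHint Nβ)))
    (hchainA : ChainQAOK D Bkey MA CsA
      (groupSlices (residTGslicesNear TXA μA νA o κA capA κA' flA TEA TGsA THA D.f EB (autoMasks THA D.f EB)
        (fun l : Fin 0 => l.elim0) (fun l : Fin 0 => l.elim0) CWA AVA) nsA) HsA)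
    {βA : ℚ} (hβA : βA ≤ lowerConst (SOSDual.decPoly N (CsA.getD MA [])) + (μA 0 + μA 1) * (n₀ / 2 - νA))
    -- vertex B
    (THB : Terms (Orb (Fin N))) (hHB : termOp d THB = (hubbardTTPrimeFermionInteraction 1 (sB : ℝ) (U : ℝ)).localHamiltonian Λ')
    (TEB : Terms (Orb (Fin N)))
    (hEB : termOp d TEB = fermionEmbed (PolySite.incl h0) ((hubbardTTPrimeFermionInteraction 1 (sB : ℝ) (U : ℝ)).meanEnergyObs 1))
    (TXB : Terms (Orb (Fin N))) (hXB : termOp d TXB = fermionEmbed (PolySite.incl h7) (X (sB : ℝ)))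
    (μB : Fin 2 → ℚ) (νB κB capB κB' flB : ℚ)
    (TGsB : List (Terms (Orb (Fin N)))) (TGfB VB : Terms (Orb (Fin N)))
    {mB : Type*} [Fintype mB] [DecidableEq mB] {ΛmB : Matrix mB mB ℂ} (hΛmB : ΛmB.PosSemidef)
    (OB : mB → FermionOp Λ') (hTGfB : termOp d TGfB = gramForm ΛmB OB)
    (hGB : termOp d TGsB.flatten = termOp d TGfB - termOp d VB + (termOp d VB)ᴴ)
    (CWB : Terms (Orb (Fin N))) (hcwB : ∀ wc ∈ CWB, chargeW wc.1 ≠ 0 ∨ spinChargeW sp wc.1 ≠ 0)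
    (AVB : List (Terms (Orb (Fin N))))
    (nsB : List ℕ) (MB : ℕ) (CsB : List SOSDual.EncPoly) (hC0B : CsB.getD 0 [] = []) (HsB : List (List (QHint Nβ)))
    (hchainB : ChainQAOK D Bkey MB CsB
      (groupSlices (residTGslicesNear TXB μB νB o κB capB κB' flB TEB TGsB THB D.f EB (autoMasks THB D.f EB)
        (fun l : Fin 0 => l.elim0) (fun l : Fin 0 => l.elim0) CWB AVB) nsB) HsB)
    {βB : ℚ} (hβB : βB ≤ lowerConst (SOSDual.decPoly N (CsB.getD MB [])) + (μB 0 + μB 1) * (n₀ / 2 - νB)) :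
    SquareTTPrimePinnedPairRowT (U : ℝ) (n₀ : ℝ) (sA : ℝ) (sB : ℝ) capA capB flA flB βA κA κA' βB κB κB' X :=
  SquareTTPrimePinnedPairRowT.of_quotAdjChainNearKernelCertsGX_wide U hU n₀ hn0 hn2 sA sB h7 hΛ h8 h0 hz D hxs hix hxsβ hcovβ d hd hdx
    Bkey dΛ hdΛ hf sp hsp hokV o ho X EB
    THA hHA TEA hEA TXA hXA μA νA κA capA κA' flA TGsA TGfA VA hΛmA OA hTGfA hGA (autoMasks THA D.f EB) (eomFarOK_autoMasks THA D.f EB)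
    CWA hcwA AVA nsA MA CsA hC0A HsA hchainA hβA
    THB hHB TEB hEB TXB hXB μB νB κB capB κB' flB TGsB TGfB VB hΛmB OB hTGfB hGB (autoMasks THB D.f EB) (eomFarOK_autoMasks THB D.f EB)
    CWB hcwB AVB nsB MB CsB hC0B HsB hchainB hβB

end KernelPairChainQuotAdjNearGX

end Summit.Ventures.CertifiedManyBodySolver.Downfold

end
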